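import Literature.Geometry.Lorentzian.KerrNullFrame
import Literature.Geometry.Lorentzian.KerrSchildMultiplierCurrent
import HarnessLib

/-!
# The bulk term of the Dafermos–Rodnianski `r^p` multiplier `X = f(r) · m` on Kerr, exactly, in the
# null frame: no `(kψ)²` term

(family `gr`; infrastructure for the far-region `r^p`-weighted estimates behind statement **gr.S24**
— the named fact `Kerr.dafermosRodnianski_pHierarchy_scri` of `KerrDecayHierarchy.lean` — in the
coefficient-field framework of `KerrSchild.multiplierBulk`; namespace `Literature.Geometry.Lorentzian.Kerr`)

Dafermos–Rodnianski (arXiv:0910.4957, §3–§4) obtain their `r^p`-weighted estimates by multiplying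
the wave equation by `r^p ∂_v(rψ)`; Moschidis (arXiv:1509.08489, §5) runs the method on general
asymptotically flat backgrounds with the multiplier `f · ∂_v` in a null frame and bookkeeping of the
errors. The structural point is that for a multiplier `X = f · m` along a **null** vector field `m`
the bulk term `K^X = T_{μν} ∇^μ X^ν = ½ T^{μν} (𝓛_X g)_{μν}` contains **no square of the transversal
null derivative** `kψ`: `(𝓛_X g)(m, m) = 2 g(∇_m(f m), m) = f · m(g(m, m)) = 0`, and `T(k, k)`-terms
only pair with `(𝓛_X g)(m, m)`. On Kerr this is what makes the method work beyond perturbation theory: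
for a multiplier along the *Minkowski* outgoing direction `L = ∂_{t*} + ∂_r` one has
`g(L, L) = 8H ≠ 0` and the bulk acquires a term `2M r^{p−2}(2p − 1) · ¼ (kψ)²`, which for `p ≥ 1` is
not controlled by any far-region estimate (the Morawetz bulk has weight `r^{-1-δ}`).

This file computes `K^X` for `X = f(r) · m`, `m = 2∂_{t*} + (1 − 2H)ℓ♯` the exact outgoing null
vector of `KerrNullFrame.lean`, for the inverse Kerr metric `g⁻¹_{M,a}` (`Kerr.inverseMetric`) in
the Kerr–Schild chart, **exactly**, as a quadratic form in `p = dw` written in the frame functionals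
`u = p(m)`, `v = p(k)` (`k = −ℓ♯`), `|p̸|²` of that file:

* `Kerr.multiplierBulk_outVector` — **the bulk of `m` itself**:
  `K^m = 2 v (p̸·∇̸H) + (1 − 2H) 𝒟(p, p) + (∂_{ℓ♯}H) |p̸|² − (1 − 2H)(2r/Σ) · ½ |p̸|²
        + (1 − 2H)(2r/Σ) · ½ · u v`,
  where `p̸·∇̸H = frameAng a x p dH` is the angular pairing with `dH` and
  `𝒟(p, p) = ∑_{ij} p_i p_j ∂_i ℓ_j` (`Kerr.nullShear`, the symmetric part of the Jacobian of the unit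
  field `ℓ⃗` as a quadratic form; it only sees `p̸`, `Kerr.nullShear_eq_of_sub`, and equals
  `(r/Σ)|p̸|²` by the shear-freeness of the Kerr congruence, which is *not* proved here): there is
  **no `u²` and no `v²` term** — the `v²`-terms of the three pieces of the coordinate formula cancel
  exactly (`S_{mm} = 0`), by the geodesy `∂_{ℓ♯}ℓ♯ = 0` and the stationarity of the chart;
* `Kerr.multiplierBulk_radial_smul_outVector` — **the bulk of `X = f(r) m`** for a differentiable
  radial profile `f`:
  `K^{f m} = f K^m + ½ f′ u² + f′ u (p̸·∇̸r) − ½ (1 − 2H) f′ |p̸|²`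
  (`KerrSchild.multiplierBulk_smul` with `g⁻¹(p, dr) = ½ u − ½(1 − 2H) v + p̸·∇̸r`, from
  `∂_{ℓ♯} r = 1`, `∂_{t*} r = 0`): the `u v` cross terms produced by `f′` cancel as well, so that
  **the only `u v` term of `K^{fm}` is `f (1 − 2H)(r/Σ) u v`** — the term removed by the
  `rψ`-renormalisation of Dafermos–Rodnianski (equivalently by the conformal weight `r⁻²`, for which
  `K^{fm}[r⁻² g⁻¹] = r⁻² (K^{fm} + (1 − 2H)(f/r) g⁻¹(p, p))`, `KerrSchild.multiplierBulk` being
  `C⁰`-linear in `G` up to the term `−½ X(r⁻²) g⁻¹(p, p)`; see `Kerr.multiplierBulk_conformal`).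

Ingredients proved here and reusable: `Kerr.fderiv_inverseMetric_apply` (the product rule
`∂_v g^{αβ} = −2 ∂_vH ℓ^βℓ^α − 2H (∂_vℓ^β ℓ^α + ℓ^β ∂_vℓ^α)`), the contractions
`Kerr.sum_sum_fderiv_inverseMetric_mul_mul` (`∑ ∂_v g^{αβ} p_α p_β = −2 ∂_vH v² + 4H v ∑ ∂_vℓ^α p_α`),
`Kerr.sum_outVector_mul_fderiv_basisVector` (`m(F) = (1 − 2H) ∂_{ℓ♯}F` for stationary `F`),
`Kerr.sum_nullCovectorFun_mul_fderiv_nullCovectorFun` (`∑_j ℓ_j ∂_v ℓ_j = 0`, `|ℓ⃗| ≡ 1`),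
stationarity of `H` and `ℓ♯` in derivative form. All statements are pointwise identities at points
with `r > 0`, for all real `M, a`; no smallness, no named facts (D-0026).

## References

* M. Dafermos, I. Rodnianski, *A new physical-space approach to decay for the wave equation with
  applications to black hole spacetimes*, XVIth ICMP (2010), arXiv:0910.4957, §3 (p-WE-Mink), §4
  (p-WE-Schw) (key `DafermosRodnianski2010ICMP`).
* G. Moschidis, *The `r^p`-weighted energy method of Dafermos and Rodnianski in general
  asymptotically flat spacetimes and applications*, Ann. PDE 2 (2016), arXiv:1509.08489, §5
  (the multiplier `f ∂_v` in a null frame; Lemma 5.2 ff.) (key `Moschidis2016`).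
* M. Dafermos, I. Rodnianski, Y. Shlapentokh-Rothman, arXiv:1402.7034 = Ann. of Math. 183 (2016),
  §2.3.1 (`K^V = T_{μν}∇^μV^ν`), §3.3 (Cor. 3.1 via the `r^p` black box)
  (key `DafermosRodnianskiShlapentokhrothman2014`).
* R. P. Kerr, A. Schild, 1965, §2 (key `KerrSchild1965`).
-/

noncomputable section

open Set Filter
open scoped Topology

namespace Literature.Geometry.Lorentzian.Kerr

variable {M a : ℝ} {x : E4}

/-! ### Stationarity and normalisation in derivative form -/

/-- A `t*`-invariant function has vanishing `∂_{t*}`-derivative wherever it is differentiable.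
[folklore] -/
theorem fderiv_basisVector_zero_eq_zero_of_invariant {F : E4 → ℝ}
    (hF : ∀ (y : E4) (t : ℝ), F (y + t • E4.basisVector 0) = F y) (hd : DifferentiableAt ℝ F x) :
    fderiv ℝ F x (E4.basisVector 0) = 0 := by
  have h1 : HasLineDerivAt ℝ F (fderiv ℝ F x (E4.basisVector 0)) x (E4.basisVector 0) :=
    hd.hasFDerivAt.hasLineDerivAt _
  have h2 : HasLineDerivAt ℝ F 0 x (E4.basisVector 0) := by
    have hev : (fun t : ℝ ↦ F (x + t • E4.basisVector 0)) = fun _ ↦ F x := by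
      funext t; exact hF x t
    show HasDerivAt (fun t : ℝ ↦ F (x + t • E4.basisVector 0)) 0 0
    rw [hev]
    exact hasDerivAt_const _ _
  exact h1.unique h2

/-- **`∂_{t*} H = 0`.** [cite: KerrSchild1965, §2] -/
theorem fderiv_scalarH_basisVector_zero (M a : ℝ) (hx : 0 < radius a x) :
    fderiv ℝ (scalarH M a) x (E4.basisVector 0) = 0 :=
  fderiv_basisVector_zero_eq_zero_of_invariant (scalarH_add_smul_basisVector_zero M a)
    ((contDiffAt_scalarH M a hx (n := 1)).differentiableAt one_ne_zero)

/-- **`∂_{t*} (ℓ♯)^μ = 0`.** [cite: KerrSchild1965, §2] -/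
theorem fderiv_nullVector_apply_basisVector_zero (a : ℝ) (hx : 0 < radius a x) (μ : Fin 4) :
    fderiv ℝ (fun y ↦ nullVector a y μ) x (E4.basisVector 0) = 0 :=
  fderiv_basisVector_zero_eq_zero_of_invariant
    (fun y t ↦ by rw [nullVector_add_smul_basisVector_zero])
    ((contDiffAt_nullVector_apply a hx (n := 1) μ).differentiableAt one_ne_zero)

/-- **`∂_{t*} r = 0`.** [cite: arXiv07060622, (35)] -/
theorem fderiv_radius_basisVector_zero (a : ℝ) (hx : 0 < radius a x) :
    fderiv ℝ (radius a) x (E4.basisVector 0) = 0 :=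
  fderiv_basisVector_zero_eq_zero_of_invariant (fun y t ↦ radius_add_time_smul_basisVector a y t)
    ((contDiffAt_radius hx (n := 1)).differentiableAt one_ne_zero)

/-- The time component of `ℓ♯` is the constant `−1`, so its derivative vanishes. [folklore] -/
theorem fderiv_nullVector_apply_zero (a : ℝ) (x v : E4) :
    fderiv ℝ (fun y ↦ nullVector a y 0) x v = 0 := by
  have : (fun y ↦ nullVector a y 0) = fun _ ↦ (-1 : ℝ) := by
    funext y; exact nullVector_apply_zero a y
  rw [this]
  simp

/-- The spatial components of `ℓ♯` are those of `ℓ`: their derivatives agree. [folklore] -/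
theorem fderiv_nullVector_apply_succ (a : ℝ) (x v : E4) (i : Fin 3) :
    fderiv ℝ (fun y ↦ nullVector a y i.succ) x v = fderiv ℝ (fun y ↦ nullCovectorFun a y i.succ) x v := by
  have : (fun y ↦ nullVector a y i.succ) = fun y ↦ nullCovectorFun a y i.succ := by
    funext y; rw [nullVector_apply, if_neg (Fin.succ_ne_zero i), one_mul]
  rw [this]

/-- **`∑_j ℓ_j ∂_v ℓ_j = 0`**: the spatial part of the null covector is a unit vector on the open set
`{r > 0}` (`Kerr.sum_sq_nullCovectorFun`), so the derivative of `|ℓ⃗|²` vanishes. [cite: arXiv07060622, (34)–(35)] -/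
theorem sum_nullCovectorFun_mul_fderiv_nullCovectorFun (hx : 0 < radius a x) (v : E4) :
    ∑ i : Fin 3, nullCovectorFun a x i.succ * fderiv ℝ (fun y ↦ nullCovectorFun a y i.succ) x v = 0 := by
  have hd : ∀ μ : Fin 4, HasFDerivAt (fun y ↦ nullCovectorFun a y μ)
      (fderiv ℝ (fun y ↦ nullCovectorFun a y μ) x) x := fun μ ↦
    ((contDiffAt_nullCovectorFun a hx (n := 1) μ).differentiableAt one_ne_zero).hasFDerivAt
  -- the function `ℓ₁² + ℓ₂² + ℓ₃²` is eventually equal to `1`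
  set F : E4 → ℝ := fun y ↦ nullCovectorFun a y 1 * nullCovectorFun a y 1 +
    nullCovectorFun a y 2 * nullCovectorFun a y 2 + nullCovectorFun a y 3 * nullCovectorFun a y 3 with hF
  have hev : F =ᶠ[𝓝 x] fun _ ↦ (1 : ℝ) := by
    have hopen : IsOpen {y : E4 | 0 < radius a y} := isOpen_lt continuous_const (continuous_radius a)
    filter_upwards [hopen.mem_nhds hx] with y hy
    have h := sum_sq_nullCovectorFun hy
    simp only [hF, ← sq]
    exact h
  have h0 : fderiv ℝ F x v = 0 := by
    rw [hev.fderiv_eq]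
    simp
  have hsum : HasFDerivAt F
      ((nullCovectorFun a x 1 • fderiv ℝ (fun y ↦ nullCovectorFun a y 1) x +
          nullCovectorFun a x 1 • fderiv ℝ (fun y ↦ nullCovectorFun a y 1) x) +
        (nullCovectorFun a x 2 • fderiv ℝ (fun y ↦ nullCovectorFun a y 2) x +
          nullCovectorFun a x 2 • fderiv ℝ (fun y ↦ nullCovectorFun a y 2) x) +
        (nullCovectorFun a x 3 • fderiv ℝ (fun y ↦ nullCovectorFun a y 3) x +
          nullCovectorFun a x 3 • fderiv ℝ (fun y ↦ nullCovectorFun a y 3) x)) x :=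
    (((hd 1).mul (hd 1)).add ((hd 2).mul (hd 2))).add ((hd 3).mul (hd 3))
  rw [hsum.fderiv] at h0
  simp only [add_apply, FunLike.coe_smul, Pi.smul_apply, smul_eq_mul] at h0
  rw [Fin.sum_univ_three]
  simp only [Fin.succ_zero_eq_one, Fin.succ_one_eq_two, fin_succ_two_eq_three]
  linarith

/-- **Geodesy, contracted**: `∑_μ (ℓ♯)^μ ∂_μ (ℓ♯)^β = ∂_{ℓ♯}(ℓ♯)^β = 0`. [cite: KerrSchild1965, §2] -/
theorem sum_nullVector_mul_fderiv_nullVector_apply (hx : 0 < radius a x) (β : Fin 4) :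
    ∑ μ, nullVector a x μ * fderiv ℝ (fun y ↦ nullVector a y β) x (E4.basisVector μ) = 0 := by
  rw [sum_nullVector_mul_fderiv_basisVector, fderiv_nullVector_apply_nullVector hx]

/-- **`m(F) = (1 − 2H) ∂_{ℓ♯}F` for a stationary `F`**: `∑_μ m^μ ∂_μF = 2∂_{t*}F + (1 − 2H)∂_{ℓ♯}F`.
[folklore] -/
theorem sum_outVector_mul_fderiv_basisVector {F : E4 → ℝ} (M a : ℝ) (x : E4)
    (h0 : fderiv ℝ F x (E4.basisVector 0) = 0) :
    ∑ μ, outVector M a x μ * fderiv ℝ F x (E4.basisVector μ) =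
      (1 - 2 * scalarH M a x) * fderiv ℝ F x (nullVector a x) := by
  have h : ∀ μ, outVector M a x μ * fderiv ℝ F x (E4.basisVector μ) =
      (if μ = 0 then 2 else 0) * fderiv ℝ F x (E4.basisVector μ) +
        (1 - 2 * scalarH M a x) * (nullVector a x μ * fderiv ℝ F x (E4.basisVector μ)) := fun μ ↦ by
    rw [outVector_apply]; ring
  simp only [h, Finset.sum_add_distrib, ← Finset.mul_sum, sum_nullVector_mul_fderiv_basisVector]
  simp [h0]

/-- `m(H) = (1 − 2H) ∂_{ℓ♯}H`. [folklore] -/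
theorem sum_outVector_mul_fderiv_scalarH (M a : ℝ) (hx : 0 < radius a x) :
    ∑ μ, outVector M a x μ * fderiv ℝ (scalarH M a) x (E4.basisVector μ) =
      (1 - 2 * scalarH M a x) * fderiv ℝ (scalarH M a) x (nullVector a x) :=
  sum_outVector_mul_fderiv_basisVector M a x (fderiv_scalarH_basisVector_zero M a hx)

/-- **`m(ℓ♯) = 0`**: `∑_μ m^μ ∂_μ (ℓ♯)^β = 0` (stationarity and geodesy). [cite: KerrSchild1965, §2] -/
theorem sum_outVector_mul_fderiv_nullVector_apply (M : ℝ) (hx : 0 < radius a x) (β : Fin 4) :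
    ∑ μ, outVector M a x μ * fderiv ℝ (fun y ↦ nullVector a y β) x (E4.basisVector μ) = 0 := by
  rw [sum_outVector_mul_fderiv_basisVector M a x (fderiv_nullVector_apply_basisVector_zero a hx β),
    fderiv_nullVector_apply_nullVector hx, mul_zero]

/-- `p(m)` for `p = dr`: **`dr(m) = 1 − 2H`** (`∂_{ℓ♯}r = 1`, `∂_{t*}r = 0`). [cite: arXiv07060622, (35)] -/
theorem frameOut_fderiv_radius (M a : ℝ) (hx : 0 < radius a x) :
    frameOut M a x (fun μ ↦ fderiv ℝ (radius a) x (E4.basisVector μ)) = 1 - 2 * scalarH M a x := by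
  rw [frameOut, sum_outVector_mul_fderiv_basisVector M a x (fderiv_radius_basisVector_zero a hx),
    fderiv_radius_nullVector hx, mul_one]

/-- `p(k)` for `p = dr`: **`dr(k) = −1`**. [cite: arXiv07060622, (35)] -/
theorem frameIn_fderiv_radius (hx : 0 < radius a x) :
    frameIn a x (fun μ ↦ fderiv ℝ (radius a) x (E4.basisVector μ)) = -1 := by
  rw [frameIn, sum_nullVector_mul_fderiv_basisVector, fderiv_radius_nullVector hx]

/-- `dH(m) = (1 − 2H) ∂_{ℓ♯}H`. [folklore] -/
theorem frameOut_fderiv_scalarH (M a : ℝ) (hx : 0 < radius a x) :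
    frameOut M a x (fun μ ↦ fderiv ℝ (scalarH M a) x (E4.basisVector μ)) =
      (1 - 2 * scalarH M a x) * fderiv ℝ (scalarH M a) x (nullVector a x) := by
  rw [frameOut, sum_outVector_mul_fderiv_scalarH M a hx]

/-- `dH(k) = −∂_{ℓ♯}H`. [folklore] -/
theorem frameIn_fderiv_scalarH (M a : ℝ) (x : E4) :
    frameIn a x (fun μ ↦ fderiv ℝ (scalarH M a) x (E4.basisVector μ)) =
      -fderiv ℝ (scalarH M a) x (nullVector a x) := by
  rw [frameIn, sum_nullVector_mul_fderiv_basisVector]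

/-! ### The derivative of the inverse metric and its contraction -/

/-- **Product rule for the inverse Kerr metric**: with `g^{αβ} = η^{αβ} − 2H ℓ^β ℓ^α`
(`Kerr.inverseMetric_apply`),
`∂_v g^{αβ} = −(2 ∂_vH ℓ^β ℓ^α + 2H (∂_vℓ^β ℓ^α + ℓ^β ∂_vℓ^α))`. [cite: KerrSchild1965, §2] -/
theorem fderiv_inverseMetric_apply (M a : ℝ) (hx : 0 < radius a x) (v : E4) (α β : Fin 4) :
    fderiv ℝ (fun y ↦ inverseMetric M a y α β) x v =
      -(2 * fderiv ℝ (scalarH M a) x v * nullVector a x β * nullVector a x α +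
        2 * scalarH M a x * (fderiv ℝ (fun y ↦ nullVector a y β) x v * nullVector a x α +
          nullVector a x β * fderiv ℝ (fun y ↦ nullVector a y α) x v)) := by
  have hH := ((contDiffAt_scalarH M a hx (n := 1)).differentiableAt one_ne_zero).hasFDerivAt
  have hβ := ((contDiffAt_nullVector_apply a hx (n := 1) β).differentiableAt one_ne_zero).hasFDerivAt
  have hα := ((contDiffAt_nullVector_apply a hx (n := 1) α).differentiableAt one_ne_zero).hasFDerivAt
  have hprod : HasFDerivAt (fun z ↦ 2 * scalarH M a z * nullVector a z β * nullVector a z α)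
      ((2 * scalarH M a x * nullVector a x β) • fderiv ℝ (fun z ↦ nullVector a z α) x +
        nullVector a x α • ((2 * scalarH M a x) • fderiv ℝ (fun z ↦ nullVector a z β) x +
          nullVector a x β • ((2 : ℝ) • fderiv ℝ (scalarH M a) x))) x :=
    ((hH.const_mul 2).mul hβ).mul hα
  have hfun : (fun z ↦ inverseMetric M a z α β) =
      fun z ↦ etaComp α β - 2 * scalarH M a z * nullVector a z β * nullVector a z α := by
    funext z
    rw [inverseMetric_apply, etaComp]
  rw [hfun, (hprod.const_sub (etaComp α β)).fderiv, neg_apply]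
  simp only [add_apply, smul_apply, smul_eq_mul]
  ring

/-- **Contraction of `∂_v g⁻¹` with a covector**: since `ℓ♯·p = −p(k)`,
`∑_{αβ} (∂_v g^{αβ}) p_α p_β = −2 (∂_vH) p(k)² + 4H p(k) ∑_α (∂_v ℓ^α) p_α`. [folklore] -/
theorem sum_sum_fderiv_inverseMetric_mul_mul (M a : ℝ) (hx : 0 < radius a x) (v : E4)
    (p : Fin 4 → ℝ) :
    ∑ α, ∑ β, fderiv ℝ (fun y ↦ inverseMetric M a y α β) x v * p α * p β =
      -2 * fderiv ℝ (scalarH M a) x v * frameIn a x p ^ 2 +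
        4 * scalarH M a x * frameIn a x p * ∑ α, fderiv ℝ (fun y ↦ nullVector a y α) x v * p α := by
  simp only [fderiv_inverseMetric_apply M a hx]
  rw [frameIn]
  -- name the atoms
  obtain ⟨l, hl⟩ : ∃ l : Fin 4 → ℝ, ∀ μ, nullVector a x μ = l μ := ⟨_, fun _ ↦ rfl⟩
  obtain ⟨dl, hdl⟩ : ∃ dl : Fin 4 → ℝ, ∀ μ, fderiv ℝ (fun y ↦ nullVector a y μ) x v = dl μ :=
    ⟨_, fun _ ↦ rfl⟩
  simp only [hl, hdl, Fin.sum_univ_four]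
  ring

/-! ### The three pieces of `K^m` -/

/-- **Piece 1a**: `∑_β (∂_v m^β) p_β = 2 (∂_vH) p(k) + (1 − 2H) ∑_β (∂_vℓ^β) p_β`. [folklore] -/
theorem sum_fderiv_outVector_apply_mul (M a : ℝ) (hx : 0 < radius a x) (v : E4) (p : Fin 4 → ℝ) :
    ∑ β, fderiv ℝ (fun y ↦ outVector M a y β) x v * p β =
      2 * fderiv ℝ (scalarH M a) x v * frameIn a x p +
        (1 - 2 * scalarH M a x) * ∑ β, fderiv ℝ (fun y ↦ nullVector a y β) x v * p β := by
  have h : ∀ β, fderiv ℝ (fun y ↦ outVector M a y β) x v * p β =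
      -2 * fderiv ℝ (scalarH M a) x v * (nullVector a x β * p β) +
        (1 - 2 * scalarH M a x) * (fderiv ℝ (fun y ↦ nullVector a y β) x v * p β) := fun β ↦ by
    rw [fderiv_outVector_apply M a hx]; ring
  simp only [h, Finset.sum_add_distrib, ← Finset.mul_sum, sum_nullVector_mul_eq_neg_frameIn]
  ring

/-- The **null shear form** `𝒟(p, p) = ∑_{i,j} p_i p_j ∂_i ℓ_j` (spatial indices): the symmetric
part of the Jacobian of the unit geodesic field `ℓ⃗` of the Kerr–Schild congruence, as a quadratic
form — twice the null second fundamental form of the congruence restricted to `ℓ⃗^⊥` (Kerr–Schild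
1965, §2: the congruence is shear-free, so that `𝒟(p, p) = (r/Σ)|p̸|²`; Visser arXiv:0706.0622, §5:
expansion `r/Σ`, twist `a cos θ/Σ`). [cite: KerrSchild1965, §2] -/
def nullShear (a : ℝ) (x : E4) (p : Fin 4 → ℝ) : ℝ :=
  ∑ i : Fin 3, ∑ j : Fin 3,
    p i.succ * p j.succ * fderiv ℝ (fun y ↦ nullCovectorFun a y j.succ) x (E4.basisVector i.succ)

/-- **Piece 1b**: with `A^μ = ∑_ν g^{μν} p_ν = η^{μμ} p_μ + 2H ℓ^μ p(k)`, geodesy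
(`∑_μ ℓ^μ ∂_μ ℓ^β = 0`), stationarity (`∂_0 ℓ^β = 0`) and `ℓ⁰ ≡ −1`:
`∑_μ A^μ ∑_β (∂_μ ℓ^β) p_β = 𝒟(p, p)`. [cite: KerrSchild1965, §2] -/
theorem sum_A_mul_sum_fderiv_nullVector_mul (M a : ℝ) (hx : 0 < radius a x) (p : Fin 4 → ℝ) :
    ∑ μ, (∑ ν, inverseMetric M a x μ ν * p ν) *
        ∑ β, fderiv ℝ (fun y ↦ nullVector a y β) x (E4.basisVector μ) * p β = nullShear a x p := by
  -- `A^μ = η^{μμ} p_μ + 2H ℓ^μ v`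
  have hA : ∀ μ, ∑ ν, inverseMetric M a x μ ν * p ν =
      (if μ = 0 then -1 else 1) * p μ + 2 * scalarH M a x * frameIn a x p * nullVector a x μ := by
    intro μ
    rw [frameIn]
    simp only [inverseMetric_apply, sub_mul, Finset.sum_sub_distrib]
    have h1 : ∑ ν, (if μ = ν then (if μ = 0 then (-1 : ℝ) else 1) else 0) * p ν =
        (if μ = 0 then -1 else 1) * p μ := by
      rw [Finset.sum_eq_single μ (fun ν _ hν ↦ by rw [if_neg (Ne.symm hν), zero_mul])
        (fun h ↦ (h (Finset.mem_univ μ)).elim), if_pos rfl]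
    rw [h1]
    simp only [mul_assoc, ← Finset.mul_sum]
    have h2 : ∑ ν, nullVector a x ν * (nullVector a x μ * p ν) =
        nullVector a x μ * ∑ ν, nullVector a x ν * p ν := by
      rw [Finset.mul_sum]; exact Finset.sum_congr rfl fun ν _ ↦ by ring
    rw [h2]
    ring
  simp only [hA, add_mul, Finset.sum_add_distrib]
  -- the geodesic part vanishes
  have hgeo : ∑ μ, 2 * scalarH M a x * frameIn a x p * nullVector a x μ *
      ∑ β, fderiv ℝ (fun y ↦ nullVector a y β) x (E4.basisVector μ) * p β = 0 := by
    have : ∀ μ, 2 * scalarH M a x * frameIn a x p * nullVector a x μ *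
        ∑ β, fderiv ℝ (fun y ↦ nullVector a y β) x (E4.basisVector μ) * p β =
        2 * scalarH M a x * frameIn a x p * ∑ β,
          (nullVector a x μ * fderiv ℝ (fun y ↦ nullVector a y β) x (E4.basisVector μ)) * p β := by
      intro μ
      rw [Finset.mul_sum, Finset.mul_sum]
      exact Finset.sum_congr rfl fun β _ ↦ by ring
    simp only [this, ← Finset.mul_sum]
    rw [Finset.sum_comm]
    simp only [← Finset.sum_mul, sum_nullVector_mul_fderiv_nullVector_apply hx, zero_mul,
      Finset.sum_const_zero, mul_zero]
  rw [hgeo, add_zero]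
  -- the time terms vanish and the spatial terms are the shear form
  rw [Fin.sum_univ_succ]
  simp only [if_pos, fderiv_nullVector_apply_basisVector_zero a hx, zero_mul, Finset.sum_const_zero,
    mul_zero, zero_add, if_neg (Fin.succ_ne_zero _), one_mul, nullShear]
  refine Finset.sum_congr rfl fun i _ ↦ ?_
  rw [Fin.sum_univ_succ, fderiv_nullVector_apply_zero, zero_mul, zero_add, Finset.mul_sum]
  exact Finset.sum_congr rfl fun j _ ↦ by rw [fderiv_nullVector_apply_succ]; ring

/-- **Piece 3**: `∑_μ m^μ ∑_{αβ} (∂_μ g^{αβ}) p_α p_β = −2 (1 − 2H)(∂_{ℓ♯}H) p(k)²`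
(`m(H) = (1 − 2H)∂_{ℓ♯}H`, `m(ℓ♯) = 0`). [cite: KerrSchild1965, §2] -/
theorem sum_outVector_mul_sum_sum_fderiv_inverseMetric (M a : ℝ) (hx : 0 < radius a x)
    (p : Fin 4 → ℝ) :
    ∑ μ, outVector M a x μ * ∑ α, ∑ β,
        fderiv ℝ (fun y ↦ inverseMetric M a y α β) x (E4.basisVector μ) * p α * p β =
      -2 * (1 - 2 * scalarH M a x) * fderiv ℝ (scalarH M a) x (nullVector a x) * frameIn a x p ^ 2 := by
  simp only [sum_sum_fderiv_inverseMetric_mul_mul M a hx, mul_add, Finset.sum_add_distrib]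
  have h1 : ∑ μ, outVector M a x μ * (-2 * fderiv ℝ (scalarH M a) x (E4.basisVector μ) *
      frameIn a x p ^ 2) = -2 * frameIn a x p ^ 2 *
        ∑ μ, outVector M a x μ * fderiv ℝ (scalarH M a) x (E4.basisVector μ) := by
    rw [Finset.mul_sum]; exact Finset.sum_congr rfl fun μ _ ↦ by ring
  have h2 : ∑ μ, outVector M a x μ * (4 * scalarH M a x * frameIn a x p *
      ∑ α, fderiv ℝ (fun y ↦ nullVector a y α) x (E4.basisVector μ) * p α) =
        4 * scalarH M a x * frameIn a x p * ∑ α,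
          (∑ μ, outVector M a x μ * fderiv ℝ (fun y ↦ nullVector a y α) x (E4.basisVector μ)) * p α := by
    simp only [Finset.mul_sum, Finset.sum_mul]
    rw [Finset.sum_comm]
    exact Finset.sum_congr rfl fun α _ ↦ Finset.sum_congr rfl fun μ _ ↦ by ring
  rw [h1, h2, sum_outVector_mul_fderiv_scalarH M a hx]
  simp only [sum_outVector_mul_fderiv_nullVector_apply M hx, zero_mul, Finset.sum_const_zero,
    mul_zero, add_zero]
  ring

/-! ### The bulk of `m` and of `f(r) m` -/

/-- **The bulk term of the exact outgoing null vector `m` on Kerr.** At a point with `r > 0`, for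
every `w : E4 → ℝ`, with `p_μ = ∂_μw`, `u = p(m)`, `v = p(k)`, `|p̸|²` the frame functionals of
`KerrNullFrame.lean`, `H_ℓ = ∂_{ℓ♯}H`, `Σ = Σ(x⃗)`, and `dH = (∂_μH)_μ`:
`K^m = 2 v (p̸·dH̸) + (1 − 2H) 𝒟(p, p) + H_ℓ |p̸|² − (1 − 2H)(2r/Σ) ½ |p̸|² + (1 − 2H)(2r/Σ) ½ u v`.
There is no `v²` (`= (kψ)²`) and no `u²` term: `(𝓛_m g)(m, m) = (𝓛_m g)(k, k) = 0` for the null,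
resp. geodesic null, vectors `m`, `k`. (Dafermos–Rodnianski arXiv:0910.4957, §3–§4 for
`a = M = 0` resp. `a = 0`, where `H_ℓ = −M/r²`, `2r/Σ = 2/r`, `dH̸ = 0`, `𝒟 = |p̸|²/r`.)
[cite: DafermosRodnianski2010ICMP, §4] -/
theorem multiplierBulk_outVector (M a : ℝ) (hx : 0 < radius a x) (w : E4 → ℝ) :
    KerrSchild.multiplierBulk (inverseMetric M a) (fun y μ ↦ outVector M a y μ) w x =
      2 * frameIn a x (fun μ ↦ fderiv ℝ w x (E4.basisVector μ)) *
          frameAng a x (fun μ ↦ fderiv ℝ w x (E4.basisVector μ))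
            (fun μ ↦ fderiv ℝ (scalarH M a) x (E4.basisVector μ)) +
        (1 - 2 * scalarH M a x) * nullShear a x (fun μ ↦ fderiv ℝ w x (E4.basisVector μ)) +
        fderiv ℝ (scalarH M a) x (nullVector a x) *
          frameAngSq a x (fun μ ↦ fderiv ℝ w x (E4.basisVector μ)) -
        (1 - 2 * scalarH M a x) * (2 * radius a x / blSigma a (E4.spatial x)) * 2⁻¹ *
          frameAngSq a x (fun μ ↦ fderiv ℝ w x (E4.basisVector μ)) +
        (1 - 2 * scalarH M a x) * (2 * radius a x / blSigma a (E4.spatial x)) * 2⁻¹ *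
          (frameOut M a x (fun μ ↦ fderiv ℝ w x (E4.basisVector μ)) *
            frameIn a x (fun μ ↦ fderiv ℝ w x (E4.basisVector μ))) := by
  -- name the covectors `p = dw`, `dH`
  obtain ⟨p, hp⟩ : ∃ p : Fin 4 → ℝ, ∀ β, fderiv ℝ w x (E4.basisVector β) = p β := ⟨_, fun _ ↦ rfl⟩
  have hpf : (fun μ ↦ fderiv ℝ w x (E4.basisVector μ)) = p := funext hp
  obtain ⟨dH, hdH⟩ : ∃ dH : Fin 4 → ℝ, ∀ β, fderiv ℝ (scalarH M a) x (E4.basisVector β) = dH β :=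
    ⟨_, fun _ ↦ rfl⟩
  have hdHf : (fun μ ↦ fderiv ℝ (scalarH M a) x (E4.basisVector μ)) = dH := funext hdH
  -- the frame lemmas, instantiated
  have eA : ∑ μ, (∑ ν, inverseMetric M a x μ ν * p ν) * dH μ =
      -2⁻¹ * (frameOut M a x p * frameIn a x dH + frameIn a x p * frameOut M a x dH) +
        frameAng a x p dH := sum_sum_inverseMetric_mul_mul_eq_frame M a x p dH
  have eOut : frameOut M a x dH = (1 - 2 * scalarH M a x) * fderiv ℝ (scalarH M a) x (nullVector a x) := by
    rw [← hdHf]; exact frameOut_fderiv_scalarH M a hx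
  have eIn : frameIn a x dH = -fderiv ℝ (scalarH M a) x (nullVector a x) := by
    rw [← hdHf]; exact frameIn_fderiv_scalarH M a x
  have e1a : ∀ μ, ∑ β, fderiv ℝ (fun y ↦ outVector M a y β) x (E4.basisVector μ) * p β =
      2 * dH μ * frameIn a x p +
        (1 - 2 * scalarH M a x) * ∑ β, fderiv ℝ (fun y ↦ nullVector a y β) x (E4.basisVector μ) * p β :=
    fun μ ↦ by rw [sum_fderiv_outVector_apply_mul M a hx, hdH]
  rw [hpf, hdHf]
  simp only [KerrSchild.multiplierBulk, hp]
  -- piece 1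
  have h1 : ∑ μ, (∑ ν, inverseMetric M a x μ ν * p ν) *
      ∑ β, fderiv ℝ (fun y ↦ outVector M a y β) x (E4.basisVector μ) * p β =
      2 * frameIn a x p * (∑ μ, (∑ ν, inverseMetric M a x μ ν * p ν) * dH μ) +
        (1 - 2 * scalarH M a x) * ∑ μ, (∑ ν, inverseMetric M a x μ ν * p ν) *
          ∑ β, fderiv ℝ (fun y ↦ nullVector a y β) x (E4.basisVector μ) * p β := by
    simp only [e1a, mul_add, Finset.sum_add_distrib, Finset.mul_sum]
    congr 1 <;> exact Finset.sum_congr rfl fun μ _ ↦ by ring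
  rw [h1, eA, eOut, eIn, sum_A_mul_sum_fderiv_nullVector_mul M a hx]
  -- piece 2
  rw [sum_fderiv_outVector_apply_basisVector M a hx, sum_inverseMetric_mul_mul_self_eq_frame]
  -- piece 3
  rw [sum_outVector_mul_sum_sum_fderiv_inverseMetric M a hx]
  ring

/-- **`g⁻¹(p, dr)` in the frame**: `∑_μ A^μ ∂_μ r = ½ u − ½(1 − 2H) v + p̸·∇̸r` (`dr(m) = 1 − 2H`,
`dr(k) = −1`). [cite: arXiv07060622, (35)] -/
theorem sum_A_mul_fderiv_radius (M a : ℝ) (hx : 0 < radius a x) (p : Fin 4 → ℝ) :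
    ∑ μ, (∑ ν, inverseMetric M a x μ ν * p ν) * fderiv ℝ (radius a) x (E4.basisVector μ) =
      2⁻¹ * frameOut M a x p - (1 - 2 * scalarH M a x) / 2 * frameIn a x p +
        frameAng a x p (fun μ ↦ fderiv ℝ (radius a) x (E4.basisVector μ)) := by
  rw [sum_sum_inverseMetric_mul_mul_eq_frame M a x p (fun μ ↦ fderiv ℝ (radius a) x (E4.basisVector μ)),
    frameOut_fderiv_radius M a hx, frameIn_fderiv_radius hx]
  ring

/-- `X(r) = f · dr(m) = (1 − 2H) f` for `X = f m`: `∑_μ m^μ ∂_μ r = 1 − 2H`. [cite: arXiv07060622, (35)] -/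
theorem sum_outVector_mul_fderiv_radius (M a : ℝ) (hx : 0 < radius a x) :
    ∑ μ, outVector M a x μ * fderiv ℝ (radius a) x (E4.basisVector μ) = 1 - 2 * scalarH M a x :=
  frameOut_fderiv_radius M a hx

/-- **The bulk term of the `r^p`-type multiplier `X = f(r) · m` on Kerr**, for a profile `f : ℝ → ℝ`
differentiable at `r(x)`: with `f = f(r(x))`, `f′ = f′(r(x))` and the notation of
`multiplierBulk_outVector`,
`K^{f m} = f · K^m + ½ f′ u² + f′ u (p̸·∇̸r) − ½ (1 − 2H) f′ |p̸|²`
(`KerrSchild.multiplierBulk_smul` with `g⁻¹(p, d(f∘r)) = f′ (½ u − ½(1 − 2H) v + p̸·∇̸r)` and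
`X(f∘r) = (1 − 2H) f f′`: the two `u v` terms produced by `f′` cancel). For `a = M = 0` and
`f = r^p` this is `½ p r^{p−1} u²  − ½ p r^{p−1} |p̸|² + r^{p−1}(|p̸|² + u v)`, which after the
renormalisation `ψ ↦ rψ` (removing `u v` and adding `r^{p−1}|p̸|²`) is the density
`½ r^{p−1} (p (∂_vΨ)² + (2 − p)|∇̸Ψ|²)` of (p-WE-Mink). [cite: DafermosRodnianski2010ICMP, §3–§4] -/
theorem multiplierBulk_radial_smul_outVector (M a : ℝ) (hx : 0 < radius a x) {f : ℝ → ℝ}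
    (hf : DifferentiableAt ℝ f (radius a x)) (w : E4 → ℝ) :
    KerrSchild.multiplierBulk (inverseMetric M a) (fun y μ ↦ f (radius a y) * outVector M a y μ) w x =
      f (radius a x) * KerrSchild.multiplierBulk (inverseMetric M a) (fun y μ ↦ outVector M a y μ) w x +
        2⁻¹ * deriv f (radius a x) * frameOut M a x (fun μ ↦ fderiv ℝ w x (E4.basisVector μ)) ^ 2 +
        deriv f (radius a x) * frameOut M a x (fun μ ↦ fderiv ℝ w x (E4.basisVector μ)) *
          frameAng a x (fun μ ↦ fderiv ℝ w x (E4.basisVector μ))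
            (fun μ ↦ fderiv ℝ (radius a) x (E4.basisVector μ)) -
        2⁻¹ * (1 - 2 * scalarH M a x) * deriv f (radius a x) *
          frameAngSq a x (fun μ ↦ fderiv ℝ w x (E4.basisVector μ)) := by
  have hr : DifferentiableAt ℝ (radius a) x := (contDiffAt_radius hx (n := 1)).differentiableAt one_ne_zero
  have hfr : DifferentiableAt ℝ (fun y ↦ f (radius a y)) x := hf.comp x hr
  have hX : ∀ α, DifferentiableAt ℝ (fun y ↦ outVector M a y α) x := fun α ↦
    (contDiffAt_outVector_apply M a hx (n := 1) α).differentiableAt one_ne_zero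
  have hchain : ∀ v, fderiv ℝ (fun y ↦ f (radius a y)) x v =
      deriv f (radius a x) * fderiv ℝ (radius a) x v := fun v ↦ by
    have h := (hf.hasDerivAt.comp_hasFDerivAt x hr.hasFDerivAt).fderiv
    rw [show (fun y ↦ f (radius a y)) = f ∘ radius a from rfl, h]
    simp [smul_eq_mul]
  -- name the covectors `p = dw`, `dr`
  obtain ⟨p, hp⟩ : ∃ p : Fin 4 → ℝ, ∀ β, fderiv ℝ w x (E4.basisVector β) = p β := ⟨_, fun _ ↦ rfl⟩
  have hpf : (fun μ ↦ fderiv ℝ w x (E4.basisVector μ)) = p := funext hp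
  obtain ⟨dr, hdr⟩ : ∃ dr : Fin 4 → ℝ, ∀ β, fderiv ℝ (radius a) x (E4.basisVector β) = dr β :=
    ⟨_, fun _ ↦ rfl⟩
  have hdrf : (fun μ ↦ fderiv ℝ (radius a) x (E4.basisVector μ)) = dr := funext hdr
  have eA : ∑ μ, (∑ ν, inverseMetric M a x μ ν * p ν) * dr μ =
      2⁻¹ * frameOut M a x p - (1 - 2 * scalarH M a x) / 2 * frameIn a x p + frameAng a x p dr := by
    have h := sum_A_mul_fderiv_radius M a hx p
    rw [hdrf] at h
    simpa only [hdr] using h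
  have eX : ∑ μ, outVector M a x μ * dr μ = 1 - 2 * scalarH M a x := by
    simpa only [hdr] using sum_outVector_mul_fderiv_radius M a hx
  rw [KerrSchild.multiplierBulk_smul (inverseMetric M a) w hfr hX, hpf, hdrf]
  simp only [hp, hchain, hdr]
  have h1 : ∑ μ, (∑ ν, inverseMetric M a x μ ν * p ν) * (deriv f (radius a x) * dr μ) =
      deriv f (radius a x) * ∑ μ, (∑ ν, inverseMetric M a x μ ν * p ν) * dr μ := by
    rw [Finset.mul_sum]; exact Finset.sum_congr rfl fun μ _ ↦ by ring
  have h2 : ∑ μ, outVector M a x μ * (deriv f (radius a x) * dr μ) =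
      deriv f (radius a x) * ∑ μ, outVector M a x μ * dr μ := by
    rw [Finset.mul_sum]; exact Finset.sum_congr rfl fun μ _ ↦ by ring
  have h3 : ∑ α, outVector M a x α * p α = frameOut M a x p := rfl
  rw [h1, h2, h3, eA, eX, sum_inverseMetric_mul_mul_self_eq_frame]
  ring

/-! ### The shear form only sees the angular part -/

/-- `𝒟` as a bilinear pairing in the first slot against `ℓ⃗` vanishes: `∑_{ij} ℓ_i q_j ∂_iℓ_j = 0`
(geodesy). [cite: KerrSchild1965, §2] -/
theorem sum_sum_nullCovectorFun_mul_mul_fderiv (hx : 0 < radius a x) (q : Fin 4 → ℝ) :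
    ∑ i : Fin 3, ∑ j : Fin 3, nullCovectorFun a x i.succ * q j.succ *
      fderiv ℝ (fun y ↦ nullCovectorFun a y j.succ) x (E4.basisVector i.succ) = 0 := by
  rw [Finset.sum_comm]
  refine Finset.sum_eq_zero fun j _ ↦ ?_
  have hgeo := fderiv_nullCovectorFun_nullVector hx j.succ
  rw [← sum_nullVector_mul_fderiv_basisVector, Fin.sum_univ_succ] at hgeo
  have h0 : fderiv ℝ (fun y ↦ nullCovectorFun a y j.succ) x (E4.basisVector 0) = 0 :=
    fderiv_basisVector_zero_eq_zero_of_invariant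
      (fun y t ↦ by rw [nullCovectorFun_add_smul_basisVector_zero])
      ((contDiffAt_nullCovectorFun a hx (n := 1) j.succ).differentiableAt one_ne_zero)
  rw [h0, mul_zero, zero_add] at hgeo
  have : ∑ i : Fin 3, nullCovectorFun a x i.succ * q j.succ *
      fderiv ℝ (fun y ↦ nullCovectorFun a y j.succ) x (E4.basisVector i.succ) =
      q j.succ * ∑ i : Fin 3, nullVector a x i.succ *
        fderiv ℝ (fun y ↦ nullCovectorFun a y j.succ) x (E4.basisVector i.succ) := by
    rw [Finset.mul_sum]
    refine Finset.sum_congr rfl fun i _ ↦ ?_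
    rw [nullVector_apply, if_neg (Fin.succ_ne_zero i)]
    ring
  rw [this, hgeo, mul_zero]

/-- `𝒟` paired in the second slot against `ℓ⃗` vanishes: `∑_{ij} q_i ℓ_j ∂_iℓ_j = 0` (`|ℓ⃗| ≡ 1`).
[cite: arXiv07060622, (34)–(35)] -/
theorem sum_sum_mul_nullCovectorFun_mul_fderiv (hx : 0 < radius a x) (q : Fin 4 → ℝ) :
    ∑ i : Fin 3, ∑ j : Fin 3, q i.succ * nullCovectorFun a x j.succ *
      fderiv ℝ (fun y ↦ nullCovectorFun a y j.succ) x (E4.basisVector i.succ) = 0 := by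
  refine Finset.sum_eq_zero fun i _ ↦ ?_
  have h := sum_nullCovectorFun_mul_fderiv_nullCovectorFun hx (E4.basisVector i.succ)
  have : ∑ j : Fin 3, q i.succ * nullCovectorFun a x j.succ *
      fderiv ℝ (fun y ↦ nullCovectorFun a y j.succ) x (E4.basisVector i.succ) =
      q i.succ * ∑ j : Fin 3, nullCovectorFun a x j.succ *
        fderiv ℝ (fun y ↦ nullCovectorFun a y j.succ) x (E4.basisVector i.succ) := by
    rw [Finset.mul_sum]
    exact Finset.sum_congr rfl fun j _ ↦ by ring
  rw [this, h, mul_zero]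

/-- **The shear form only sees the angular part of `p`**: subtracting from the spatial part of `p`
any multiple of `ℓ⃗` does not change `𝒟(p, p)`: for `q_{i} = p_{i} − c ℓ_{i}` (`i = 1, 2, 3`),
`𝒟(q, q) = 𝒟(p, p)` (by `(ℓ⃗·∇)ℓ⃗ = 0` and `∇|ℓ⃗|² = 0`). With `c = ℓ⃗·p⃗` this is `𝒟(p, p) = 𝒟(p̸, p̸)`.
[cite: KerrSchild1965, §2] -/
theorem nullShear_eq_of_sub (hx : 0 < radius a x) (p q : Fin 4 → ℝ) (c : ℝ)
    (hq : ∀ i : Fin 3, q i.succ = p i.succ - c * nullCovectorFun a x i.succ) :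
    nullShear a x q = nullShear a x p := by
  have h1 := sum_sum_nullCovectorFun_mul_mul_fderiv hx p
  have h2 := sum_sum_mul_nullCovectorFun_mul_fderiv hx p
  have h3 := sum_sum_nullCovectorFun_mul_mul_fderiv hx (fun μ ↦ nullCovectorFun a x μ)
  simp only [nullShear, hq]
  have : ∀ i j : Fin 3, (p i.succ - c * nullCovectorFun a x i.succ) * (p j.succ - c * nullCovectorFun a x j.succ) *
      fderiv ℝ (fun y ↦ nullCovectorFun a y j.succ) x (E4.basisVector i.succ) =
      p i.succ * p j.succ * fderiv ℝ (fun y ↦ nullCovectorFun a y j.succ) x (E4.basisVector i.succ) -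
        c * (nullCovectorFun a x i.succ * p j.succ *
          fderiv ℝ (fun y ↦ nullCovectorFun a y j.succ) x (E4.basisVector i.succ)) -
        c * (p i.succ * nullCovectorFun a x j.succ *
          fderiv ℝ (fun y ↦ nullCovectorFun a y j.succ) x (E4.basisVector i.succ)) +
        c ^ 2 * (nullCovectorFun a x i.succ * nullCovectorFun a x j.succ *
          fderiv ℝ (fun y ↦ nullCovectorFun a y j.succ) x (E4.basisVector i.succ)) := by
    intro i j; ring
  simp only [this, Finset.sum_add_distrib, Finset.sum_sub_distrib, ← Finset.mul_sum, h1, h2, h3]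
  ring

/-! ### The conformal weight: `K` for `φ · g⁻¹` -/

/-- **The bulk term for a conformally rescaled coefficient field**: for a scalar `φ` differentiable at
`x`, `K^X[φ G] = φ K^X[G] − ½ X(φ) · ∑ G^{αβ} p_α p_β` (the coordinate formula is `C⁰`-linear in `G`
except for the last term, which differentiates `G`). Used with `φ = r⁻²` (`X(r⁻²) = −2r⁻³ X(r)`): the
operator `∂_μ(r⁻² g^{μν} ∂_ν ·)` is, up to the factor `r⁻¹` and a zeroth-order term, the wave
operator conjugated by `r` (`r □_g (Ψ/r)`-type), i.e. the equation for `Ψ = rψ` of the `r^p` method.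
[cite: DafermosRodnianski2010ICMP, §3] -/
theorem _root_.Literature.Geometry.Lorentzian.KerrSchild.multiplierBulk_conformal
    (G : E4 → Fin 4 → Fin 4 → ℝ) {φ : E4 → ℝ} (X : E4 → Fin 4 → ℝ) (w : E4 → ℝ) {x : E4}
    (hφ : DifferentiableAt ℝ φ x) (hG : ∀ α β, DifferentiableAt ℝ (fun y ↦ G y α β) x) :
    KerrSchild.multiplierBulk (fun y α β ↦ φ y * G y α β) X w x =
      φ x * KerrSchild.multiplierBulk G X w x -
        2⁻¹ * (∑ μ, X x μ * fderiv ℝ φ x (E4.basisVector μ)) *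
          ∑ α, ∑ β, G x α β * fderiv ℝ w x (E4.basisVector α) * fderiv ℝ w x (E4.basisVector β) := by
  have hd : ∀ α β, fderiv ℝ (fun y ↦ φ y * G y α β) x =
      φ x • fderiv ℝ (fun y ↦ G y α β) x + G x α β • fderiv ℝ φ x := fun α β ↦
    fderiv_mul hφ (hG α β)
  simp only [KerrSchild.multiplierBulk, hd, add_apply, smul_apply, smul_eq_mul]
  obtain ⟨p, hp⟩ : ∃ p : Fin 4 → ℝ, ∀ β, fderiv ℝ w x (E4.basisVector β) = p β := ⟨_, fun _ ↦ rfl⟩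
  obtain ⟨dX, hdX⟩ : ∃ dX : Fin 4 → Fin 4 → ℝ, ∀ μ β,
      fderiv ℝ (fun y ↦ X y β) x (E4.basisVector μ) = dX μ β := ⟨_, fun _ _ ↦ rfl⟩
  obtain ⟨dφ, hdφ⟩ : ∃ dφ : Fin 4 → ℝ, ∀ μ, fderiv ℝ φ x (E4.basisVector μ) = dφ μ := ⟨_, fun _ ↦ rfl⟩
  obtain ⟨dG, hdG⟩ : ∃ dG : Fin 4 → Fin 4 → Fin 4 → ℝ, ∀ μ α β,
      fderiv ℝ (fun y ↦ G y α β) x (E4.basisVector μ) = dG μ α β := ⟨_, fun _ _ _ ↦ rfl⟩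
  simp only [hp, hdX, hdφ, hdG]
  simp only [Fin.sum_univ_four, Fin.isValue]
  ring

end Literature.Geometry.Lorentzian.Kerr
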